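import Literature.Barriers.CriticalPhenomena.PlaquetteWalkHoleRootNoKiss
import HarnessLib

/-!
# Barrier catalogue (SAWScalingLimit): NO DOUBLY VISITED PLAQUETTE in a wound cost-`7` class-`B2a` walk with VERTICAL end and turning first arc
(«NO KISS AT COST SEVEN»)

`Z → ∞` limit model of the printed Yang–Baxter weights [GlazmanManolescu2019, §1, eq. (1)]; the «RECTANGLE COEFFICIENT» line of the venture lane
«pcv-sawmu» (b-engine-1 g26). This is (R2) for the PARENTS of the class-`B2b` members of limit cost `5` — wound class-`B2a` walks of cost `7` that
return to a VERTICAL side of the rooted rhombus `r` and whose first arc in `r` turns (`PlaquetteWalkHoleRootExtensionCost.cost_ext₃_eq_five_iff`) —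
i.e. the second disjunct of the hypothesis `hR2` of the ROOT-ROW LAW `PlaquetteWalkHoleRootRowLaw.vertexFunctional_printed_zero_set_finite_of_noDoubleVisit`
(census kit j280313: `n_{w₁} = n_{w₂} = 0`).

★★★★ `ΩG.injective_of_cost_seven_vert`, by the CHAIN CALCULUS of `PlaquetteWalkKissChains`: such a walk has `n_{u₁} + n_{u₂} = 6` isolated turns —
the rooted rhombus `r` itself (middle row), the entry and exit turns of the top row and of the bottom row (#803/#809), and a sixth; the horizontal
chain east of `r`, or east of the last plaquette `r + (1,0)` when the walk ends on `r`'s east side, produces an isolated turn `ρ` on the root row east of `r`,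
which is therefore the sixth. A doubly visited plaquette `κ` then lies on the root row (its eastward chain ends at `r`, at `ρ` or at the last plaquette),
and the vertical chains of `κ` (two ends), of `r`, of `ρ`, together with the left entry turn of column `X ≤ w.1 − 2` (#838), give FIVE distinct isolated turns
in the extreme rows, one too many. [GlazmanManolescu2019 §1 Fig. 1, eq. (1), Lemma 2.1, Remark 2.2; Glazman2015WeightedSAW Lemma 3.1 (proof, pp. 6–7)]
-/

noncomputable section

namespace Literature.Probability.RandomPlanarGeometry.SAW.YangBaxter

open Real
open Literature.Barriers.CriticalPhenomena.PlaquetteWalk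

open private fc_fh fh_add_Mv three_le_Mv from Literature.Probability.RandomPlanarGeometry.YangBaxterSAWGeneralDomain

namespace ΩG

variable {D : Set Face} {w r : Face} {ω : ΩG D (w.side .W) r}

/-- The last arc of a walk returning to a VERTICAL side of `r`: it lies in the east neighbour of `r` and leaves through `W` (end on `r`'s `E` side), or in
the west neighbour and leaves through `E` (end on the `W` side). [cite: GlazmanManolescu2019, §1, Fig. 1; Lemma 2.1 (the classes of walks through a rhombus)] -/
theorem last_of_vertical_end (hr : RootedFace D (w.side .W) r) (h : ω.IsB2a) (hz : ω.1 = .E ∨ ω.1 = .W) :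
    (ω.1 = .E ∧ ω.2.sOut (ω.2.arcs.length - 1) = .W ∧ ω.2.fc (ω.2.arcs.length - 1) = (r.1 + 1, r.2)) ∨
      (ω.1 = .W ∧ ω.2.sOut (ω.2.arcs.length - 1) = .E ∧ ω.2.fc (ω.2.arcs.length - 1) = (r.1 - 1, r.2)) := by
  have hlen : 0 < ω.2.arcs.length := by have := ω.fh_lt h; omega
  have hne := fc_last_ne_root hr h
  obtain ⟨-, hout⟩ := ω.2.side_sIn_eq_nth (show ω.2.arcs.length - 1 < ω.2.arcs.length by omega)
  rw [show ω.2.arcs.length - 1 + 1 = ω.2.arcs.length by omega, ω.2.nth_length] at hout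
  rcases hfc : ω.2.fc (ω.2.arcs.length - 1) with ⟨x, y⟩
  rw [hfc] at hout hne
  rcases r with ⟨r1, r2⟩
  generalize hs : ω.2.sOut (ω.2.arcs.length - 1) = s at hout ⊢
  generalize ht : ω.1 = t at hout hz ⊢
  simp only [ne_eq, Prod.mk.injEq] at hne ⊢
  rcases hz with rfl | rfl <;> cases s <;>
    simp only [Face.side, MidEdge.vert.injEq, reduceCtorEq, and_false, false_and, or_false, false_or, true_and] at hout ⊢ <;> omega

/-- ★★★★ **NO DOUBLY VISITED PLAQUETTE AT LIMIT COST `7` WITH A VERTICAL END (root row).** A wound class-`B2a` walk from the hole root `w.side W` (hole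
`(w.1 − 1, w.2)` absent) at a rhombus `r` of the root row east of the hole (`r.2 = w.2`, `w.1 ≤ r.1`), of limit cost `7`, returning to a VERTICAL side of `r`
and with a TURNING first arc in `r`, visits no plaquette twice. [cite: GlazmanManolescu2019, §1, Fig. 1 and eq. (1); Lemma 2.1; Remark 2.2]
[cite: Glazman2015WeightedSAW, Lemma 3.1 (proof, pp. 6–7)] [cite: CourantRobbins1958, Ch. V Appendix §2 (the even–odd rule)] -/
theorem injective_of_cost_seven_vert (hh : holeFaceW w ∉ D) (hr : RootedFace D (w.side .W) r) (h : ω.IsB2a)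
    (hA : ω.AJ hr h (toC (midPt (w.side .W))) ≠ 0) (hc : cost (slotOfSide ω.1) ω.2.mids = 7) (hz : ω.1 = .E ∨ ω.1 = .W)
    (hNS : arcKind (ω.2.sIn ω.2.firstHitG) (ω.2.sOut ω.2.firstHitG) ≠ .straight) (hrow : r.2 = w.2) (hcol : w.1 ≤ r.1) :
    ∀ i j, i < ω.2.arcs.length → j < ω.2.arcs.length → ω.2.fc i = ω.2.fc j → i = j := by
  classical
  intro i j hi hj he
  by_contra hij
  set n := ω.2.arcs.length with hn
  set κ := ω.2.fc i with hκ
  have hκall : ∀ s, ω.2.UsesSide κ s := fun s => ω.2.usesSide_of_fc_eq hi hj hij he s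
  -- counts: six isolated turns
  have hd : slotDeg (slotOfSide ω.1) = 0 := by rcases hz with e | e <;> rw [e] <;> rfl
  have h6 : cfgCount ω.2.mids [.corner] + cfgCount ω.2.mids [.coCorner] = 6 := by
    have hcost : cost (slotOfSide ω.1) ω.2.mids =
        cfgCount ω.2.mids [.corner] + cfgCount ω.2.mids [.coCorner] + (1 - slotDeg (slotOfSide ω.1)) := rfl
    rw [hcost, hd] at hc; omega
  let P : Face → Prop := fun f => f ∈ facesL ω.2.mids ∧ (kindsL ω.2.mids f = [.corner] ∨ kindsL ω.2.mids f = [.coCorner])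
  have hPiso : ∀ k < n, (∀ l < n, ω.2.fc l = ω.2.fc k → l = k) → arcKind (ω.2.sIn k) (ω.2.sOut k) ≠ .straight → P (ω.2.fc k) :=
    fun k hk hsv hkind => isolated_turn hk hsv hkind
  have hle6 : ∀ T : Finset Face, (∀ f ∈ T, P f) → T.card ≤ 6 := by
    intro T hT; have := YBWalk.card_le_cfgCount_add ω.2.mids T hT; omega
  -- the first arc, the last arc
  have hF := ω.fh_lt h
  have hlen : 0 < n := by omega
  have h0w : ω.2.fc 0 = w := fc_zero_eq_root w hh ω.2 hlen
  have h0W : ω.2.sIn 0 = .W := YBWalk.sIn_zero_eq_W hh ω.2 hlen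
  have h0E : ω.2.sIn 0 ≠ .E := by rw [h0W]; decide
  have h0N : ω.2.sIn 0 ≠ .N := by rw [h0W]; decide
  have h0S : ω.2.sIn 0 ≠ .S := by rw [h0W]; decide
  have hlast := last_of_vertical_end hr h hz
  have hzN : ω.2.sOut (n - 1) ≠ .N := by rcases hlast with ⟨-, e, -⟩ | ⟨-, e, -⟩ <;> rw [e] <;> decide
  have hzS : ω.2.sOut (n - 1) ≠ .S := by rcases hlast with ⟨-, e, -⟩ | ⟨-, e, -⟩ <;> rw [e] <;> decide
  have hZrow : (ω.2.fc (n - 1)).2 = w.2 := by rcases hlast with ⟨-, -, e⟩ | ⟨-, -, e⟩ <;> rw [e] <;> exact hrow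
  have hfne3 : ω.2.firstHitG + 3 ≤ n := by have := three_le_Mv hr h; have := fh_add_Mv h; unfold ΩG.Mv at *; omega
  -- the rooted rhombus: singly visited, its arc turns and uses exactly one horizontal side
  have hfcF := (fc_fh ω hr h).1
  have hsvr : ∀ l < n, ω.2.fc l = ω.2.fc ω.2.firstHitG → l = ω.2.firstHitG := fun l hl e => eq_firstHitG_of_fc_eq hr h hl e
  have hPr : P r := by rw [← hfcF]; exact hPiso _ hF hsvr hNS
  have hrside : ∀ s, ω.2.UsesSide r s → r.side s ≠ r.side ω.1 := by
    rintro s ⟨l, hl, hfl, hs⟩ e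
    have hl' := hsvr l hl (hfl.trans hfcF.symm)
    obtain ⟨hin, hout⟩ := ω.2.side_sIn_eq_nth hl
    rw [hfl] at hin hout
    rw [← ω.2.nth_length] at e
    rcases hs with hs | hs
    · rw [hs] at hin; have := ω.2.nth_inj (show l ≤ n by omega) le_rfl (hin.symm.trans e).symm.symm; omega
    · rw [hs] at hout; have := ω.2.nth_inj (show l + 1 ≤ n by omega) le_rfl (hout.symm.trans e).symm.symm; omega
  have hneF := ω.2.sIn_ne_sOut hF
  have hrEW : ω.2.UsesSide r .E ∨ ω.2.UsesSide r .W := by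
    have key : (ω.2.sIn ω.2.firstHitG = .E ∨ ω.2.sOut ω.2.firstHitG = .E) ∨ (ω.2.sIn ω.2.firstHitG = .W ∨ ω.2.sOut ω.2.firstHitG = .W) := by
      revert hNS hneF; cases ω.2.sIn ω.2.firstHitG <;> cases ω.2.sOut ω.2.firstHitG <;> decide
    rcases key with hE | hW
    · exact Or.inl ⟨_, hF, hfcF, hE⟩
    · exact Or.inr ⟨_, hF, hfcF, hW⟩
  have hrNS : ω.2.UsesSide r .N ∨ ω.2.UsesSide r .S := by
    have key : (ω.2.sIn ω.2.firstHitG = .N ∨ ω.2.sOut ω.2.firstHitG = .N) ∨ (ω.2.sIn ω.2.firstHitG = .S ∨ ω.2.sOut ω.2.firstHitG = .S) := by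
      revert hNS hneF; cases ω.2.sIn ω.2.firstHitG <;> cases ω.2.sOut ω.2.firstHitG <;> decide
    rcases key with hN | hS
    · exact Or.inl ⟨_, hF, hfcF, hN⟩
    · exact Or.inr ⟨_, hF, hfcF, hS⟩
  -- extreme rows: entry and exit turns
  obtain ⟨Y, hYw, hY, i₀, i₁, -, hi₀2, hrow₀, hS₀, hWE₀, -, hi₁, hrow₁, -, halt⟩ := top_exit_or_end hh hr h hA
  obtain ⟨hS₁, hWE₁, -, hfne⟩ : (ω.2.sOut i₁ = .S ∧ (ω.2.sIn i₁ = .W ∨ ω.2.sIn i₁ = .E) ∧ i₀ ≠ i₁ ∧ ω.2.fc i₀ ≠ ω.2.fc i₁) := by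
    rcases halt with hh' | ⟨-, -, hrY⟩
    · exact hh'
    · exfalso; omega
  obtain ⟨Y', hY'w, hY', j₀, j₁, -, hj₀2, hrow₀', hN₀', hWE₀', -, hj₁, hrow₁', -, halt'⟩ := bottom_exit_or_end hh hr h hA
  obtain ⟨hN₁', hWE₁', -, hfne'⟩ : (ω.2.sOut j₁ = .N ∧ (ω.2.sIn j₁ = .W ∨ ω.2.sIn j₁ = .E) ∧ j₀ ≠ j₁ ∧ ω.2.fc j₀ ≠ ω.2.fc j₁) := by
    rcases halt' with hh' | ⟨-, -, hrY⟩
    · exact hh'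
    · exfalso; omega
  have hi₀ : i₀ < n := by omega
  have hj₀ : j₀ < n := by omega
  have hsvT : ∀ k, k < n → (ω.2.fc k).2 = Y → ∀ l < n, ω.2.fc l = ω.2.fc k → l = k :=
    fun k hk hrw l hl e => (top_single_visit hh hr h hY (by omega) hk hl hrw e.symm).symm
  have hsvB : ∀ k, k < n → (ω.2.fc k).2 = Y' → ∀ l < n, ω.2.fc l = ω.2.fc k → l = k :=
    fun k hk hrw l hl e => (bottom_single_visit hh hr h hY' (by omega) hk hl hrw e.symm).symm
  have hPt₀ : P (ω.2.fc i₀) := hPiso i₀ hi₀ (hsvT i₀ hi₀ hrow₀) (by rw [hS₀]; exact YBWalk.arcKind_ne_straight_of_S_WE (Or.inl rfl) hWE₀)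
  have hPt₁ : P (ω.2.fc i₁) := hPiso i₁ hi₁ (hsvT i₁ hi₁ hrow₁) (by rw [hS₁]; exact YBWalk.arcKind_ne_straight_of_WE_S hWE₁ (Or.inl rfl))
  have hPb₀ : P (ω.2.fc j₀) := hPiso j₀ hj₀ (hsvB j₀ hj₀ hrow₀') (by rw [hN₀']; exact YBWalk.arcKind_ne_straight_of_S_WE (Or.inr rfl) hWE₀')
  have hPb₁ : P (ω.2.fc j₁) := hPiso j₁ hj₁ (hsvB j₁ hj₁ hrow₁') (by rw [hN₁']; exact YBWalk.arcKind_ne_straight_of_WE_S hWE₁' (Or.inr rfl))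
  have hNtop := forall_top_ne_N hh hr h hY (by omega)
  have hSbot := forall_bottom_ne_S hh hr h hY' (by omega)
  -- the extreme columns
  obtain ⟨X, hXw, hX, sL, -, hsL, hcolL, -, hinL, houtL⟩ := exists_left_entry_turn hh hr h hA
  obtain ⟨X', -, hX', -⟩ := exists_right_entry_turn hh hr h
  have hsvσ : ∀ l < n, ω.2.fc l = ω.2.fc sL → l = sL :=
    fun l hl e => (left_single_visit hh hr h hX (by omega) hsL hl hcolL e.symm).symm
  have hPσ : P (ω.2.fc sL) := hPiso sL hsL hsvσ (by rw [hinL]; rcases houtL with e | e <;> rw [e] <;> decide)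
  ---------------------------------------------------------------- `ρ`: an isolated turn on the root row east of `r`, using `W`
  have hρ : ∃ ρ1 : ℤ, r.1 < ρ1 ∧ ω.2.UsesSide (ρ1, w.2) .W ∧ ¬ω.2.UsesSide (ρ1, w.2) .E := by
    rcases hrEW with hrE | hrW
    · -- `r` uses `E`: the walk ends on the `W` side, and the chain east of `r` ends at an isolated turn
      have hω : ω.1 = .W := by
        rcases hz with e | e
        · exact absurd (by rw [e]) (hrside _ hrE)
        · exact e
      obtain ⟨M, hWall, -, hend⟩ := ω.2.chain_E hX' hrE
      rcases hend with ⟨hM1, hnot⟩ | ⟨-, hs0⟩ | ⟨hZ, -⟩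
      · refine ⟨r.1 + M, by omega, ?_, ?_⟩
        · have := hWall M hM1 le_rfl; rwa [hrow] at this
        · rwa [hrow] at hnot
      · exact absurd hs0 h0E
      · exfalso
        rcases hlast with ⟨e, -, -⟩ | ⟨-, -, e⟩
        · rw [hω] at e; exact absurd e (by decide)
        · rw [e] at hZ; have := congrArg Prod.fst hZ; simp only at this; omega
    · -- `r` uses `W`: the walk ends on the `E` side, from the last plaquette `r + (1,0)` leaving through `W`
      have hω : ω.1 = .E := by
        rcases hz with e | e
        · exact e
        · exact absurd (by rw [e]) (hrside _ hrW)
      obtain ⟨hsW, hfcZ⟩ : ω.2.sOut (n - 1) = .W ∧ ω.2.fc (n - 1) = (r.1 + 1, r.2) := by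
        rcases hlast with ⟨-, h1, h2⟩ | ⟨e, -, -⟩
        · exact ⟨h1, h2⟩
        · rw [hω] at e; exact absurd e (by decide)
      have hcW : ω.2.UsesSide (r.1 + 1, w.2) .W := ⟨n - 1, by omega, by rw [hfcZ, hrow], Or.inr hsW⟩
      by_cases hcE : ω.2.UsesSide (r.1 + 1, w.2) .E
      · obtain ⟨M, hWall, -, hend⟩ := ω.2.chain_E hX' hcE
        rcases hend with ⟨hM1, hnot⟩ | ⟨-, hs0⟩ | ⟨-, hsZ⟩
        · exact ⟨r.1 + 1 + M, by omega, hWall M hM1 le_rfl, hnot⟩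
        · exact absurd hs0 h0E
        · rw [hsW] at hsZ; exact absurd hsZ (by decide)
      · exact ⟨r.1 + 1, by omega, hcW, hcE⟩
  obtain ⟨ρ1, hρ1, hρW, hρE⟩ := hρ
  obtain ⟨iρ, hiρ, hfcρ, hsvρ, hWρ, hninρ, hnoutρ, hkρ⟩ := ω.2.isolated_of_usesSide_not_opp hρW hρE
  have hPρ : P (ρ1, w.2) := by rw [← hfcρ]; exact hPiso iρ hiρ hsvρ hkρ
  ---------------------------------------------------------------- the six isolated turns
  let S6 : Finset Face := {r, (ρ1, w.2), ω.2.fc i₀, ω.2.fc i₁, ω.2.fc j₀, ω.2.fc j₁}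
  have hS6P : ∀ f ∈ S6, P f := by
    intro f hf
    simp only [S6, Finset.mem_insert, Finset.mem_singleton] at hf
    rcases hf with rfl | rfl | rfl | rfl | rfl | rfl
    · exact hPr
    · exact hPρ
    · exact hPt₀
    · exact hPt₁
    · exact hPb₀
    · exact hPb₁
  have hS6card : S6.card = 6 := by
    simp only [S6]
    rw [Finset.card_insert_of_notMem, Finset.card_insert_of_notMem, Finset.card_insert_of_notMem,
      Finset.card_insert_of_notMem, Finset.card_insert_of_notMem, Finset.card_singleton]
    · simp only [Finset.mem_singleton]; exact hfne'
    · simp only [Finset.mem_insert, Finset.mem_singleton, not_or]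
      exact ⟨fun e => by have := congrArg Prod.snd e; rw [hrow₁, hrow₀'] at this; omega,
        fun e => by have := congrArg Prod.snd e; rw [hrow₁, hrow₁'] at this; omega⟩
    · simp only [Finset.mem_insert, Finset.mem_singleton, not_or]
      exact ⟨hfne, fun e => by have := congrArg Prod.snd e; rw [hrow₀, hrow₀'] at this; omega,
        fun e => by have := congrArg Prod.snd e; rw [hrow₀, hrow₁'] at this; omega⟩
    · simp only [Finset.mem_insert, Finset.mem_singleton, not_or]
      exact ⟨fun e => by have := congrArg Prod.snd e; rw [hrow₀] at this; simp only at this; omega,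
        fun e => by have := congrArg Prod.snd e; rw [hrow₁] at this; simp only at this; omega,
        fun e => by have := congrArg Prod.snd e; rw [hrow₀'] at this; simp only at this; omega,
        fun e => by have := congrArg Prod.snd e; rw [hrow₁'] at this; simp only at this; omega⟩
    · simp only [Finset.mem_insert, Finset.mem_singleton, not_or]
      exact ⟨fun e => by have := congrArg Prod.fst e; simp only at this; omega,
        fun e => by have := congrArg Prod.snd e; rw [hrow₀] at this; omega,
        fun e => by have := congrArg Prod.snd e; rw [hrow₁] at this; omega,
        fun e => by have := congrArg Prod.snd e; rw [hrow₀'] at this; omega,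
        fun e => by have := congrArg Prod.snd e; rw [hrow₁'] at this; omega⟩
  have hall : ∀ f, P f → f ∈ S6 := by
    intro f hf
    by_contra hnot
    have := hle6 (insert f S6) (fun g hg => by
      rcases Finset.mem_insert.1 hg with rfl | hg
      · exact hf
      · exact hS6P g hg)
    rw [Finset.card_insert_of_notMem hnot, hS6card] at this
    omega
  -- the four extreme-row turns
  let F4 : Finset Face := {ω.2.fc i₀, ω.2.fc i₁, ω.2.fc j₀, ω.2.fc j₁}
  have hF4card : F4.card ≤ 4 := Finset.card_le_four
  -- an isolated turn off the root row is one of the four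
  have hoff : ∀ f, P f → f.2 ≠ w.2 → f ∈ F4 := by
    intro f hf hf2
    have hm := hall f hf
    simp only [S6, Finset.mem_insert, Finset.mem_singleton] at hm
    simp only [F4, Finset.mem_insert, Finset.mem_singleton]
    rcases hm with rfl | rfl | hm | hm | hm | hm
    · exact absurd hrow hf2
    · exact absurd rfl hf2
    · exact Or.inl hm
    · exact Or.inr (Or.inl hm)
    · exact Or.inr (Or.inr (Or.inl hm))
    · exact Or.inr (Or.inr (Or.inr hm))
  -- members of the four lie in the extreme rows
  have hF4row : ∀ f ∈ F4, f.2 = Y ∨ f.2 = Y' := by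
    intro f hf
    simp only [F4, Finset.mem_insert, Finset.mem_singleton] at hf
    rcases hf with rfl | rfl | rfl | rfl
    · exact Or.inl hrow₀
    · exact Or.inl hrow₁
    · exact Or.inr hrow₀'
    · exact Or.inr hrow₁'
  ---------------------------------------------------------------- `κ` lies on the root row, off the columns of `r`, `ρ`, `X`
  have hκY : κ.2 < Y := lt_of_le_of_ne (hY i hi) (fun e => hij (top_single_visit hh hr h hY (by omega) hi hj e he))
  have hκY' : Y' < κ.2 := lt_of_le_of_ne (hY' i hi) (fun e => hij (bottom_single_visit hh hr h hY' (by omega) hi hj e.symm he))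
  have hκ2 : κ.2 = w.2 := by
    obtain ⟨M, hWall, -, hend⟩ := ω.2.chain_E hX' (hκall .E)
    rcases hend with ⟨hM1, hnot⟩ | ⟨-, hs0⟩ | ⟨hZ, -⟩
    · obtain ⟨i', hi', hfc', hsv', -, -, -, hk'⟩ := ω.2.isolated_of_usesSide_not_opp (hWall M hM1 le_rfl) hnot
      have hP' : P (κ.1 + M, κ.2) := by rw [← hfc']; exact hPiso i' hi' hsv' hk'
      by_contra hne
      rcases hF4row _ (hoff _ hP' hne) with e | e <;> simp only at e <;> omega
    · exact absurd hs0 h0E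
    · have := congrArg Prod.snd hZ; rw [hZrow] at this; simpa using this
  have hκr : κ.1 ≠ r.1 := by
    intro e
    have hκr' : κ = r := Prod.ext e (hκ2.trans hrow.symm)
    have e1 := hsvr i hi (hκr'.trans hfcF.symm)
    have e2 := hsvr j hj (he.symm.trans (hκr'.trans hfcF.symm))
    exact hij (e1.trans e2.symm)
  have hκρ : κ.1 ≠ ρ1 := by
    intro e
    have hκρ' : κ = ω.2.fc iρ := by rw [hfcρ]; exact Prod.ext e hκ2
    have e1 := hsvρ i hi hκρ'
    have e2 := hsvρ j hj (he.symm.trans hκρ')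
    exact hij (e1.trans e2.symm)
  have hκX : κ.1 ≠ X := fun e => hij (left_single_visit hh hr h hX (by omega) hi hj e he)
  ---------------------------------------------------------------- five extreme-row isolated turns in four slots
  -- the two vertical chain ends of `κ`
  obtain ⟨Mu, hSu, -, hendu⟩ := ω.2.chain_N hY (hκall .N)
  obtain ⟨hMu1, hTκ⟩ : 1 ≤ Mu ∧ (κ.1, w.2 + (Mu : ℤ)) ∈ F4 := by
    rcases hendu with ⟨hMu1, hnot⟩ | ⟨-, hs0⟩ | ⟨-, hsZ⟩
    · obtain ⟨i', hi', hfc', hsv', -, -, -, hk'⟩ := ω.2.isolated_of_usesSide_not_opp (hSu Mu hMu1 le_rfl) hnot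
      have hP' : P (κ.1, κ.2 + Mu) := by rw [← hfc']; exact hPiso i' hi' hsv' hk'
      rw [hκ2] at hP'
      exact ⟨hMu1, hoff _ hP' (by simp only; omega)⟩
    · exact absurd hs0 h0N
    · exact absurd hsZ hzN
  obtain ⟨Md, hNd, -, hendd⟩ := ω.2.chain_S hY' (hκall .S)
  obtain ⟨hMd1, hBκ⟩ : 1 ≤ Md ∧ (κ.1, w.2 - (Md : ℤ)) ∈ F4 := by
    rcases hendd with ⟨hMd1, hnot⟩ | ⟨-, hs0⟩ | ⟨-, hsZ⟩
    · obtain ⟨i', hi', hfc', hsv', -, -, -, hk'⟩ := ω.2.isolated_of_usesSide_not_opp (hNd Md hMd1 le_rfl) hnot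
      have hP' : P (κ.1, κ.2 - Md) := by rw [← hfc']; exact hPiso i' hi' hsv' hk'
      rw [hκ2] at hP'
      exact ⟨hMd1, hoff _ hP' (by simp only; omega)⟩
    · exact absurd hs0 h0S
    · exact absurd hsZ hzS
  -- the vertical chain end of `r`
  obtain ⟨yR, hyR, hR'⟩ : ∃ yR : ℤ, yR ≠ w.2 ∧ (r.1, yR) ∈ F4 := by
    rcases hrNS with hrN | hrS
    · obtain ⟨M, hS', -, hend⟩ := ω.2.chain_N hY hrN
      rcases hend with ⟨hM1, hnot⟩ | ⟨-, hs0⟩ | ⟨-, hsZ⟩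
      · obtain ⟨i', hi', hfc', hsv', -, -, -, hk'⟩ := ω.2.isolated_of_usesSide_not_opp (hS' M hM1 le_rfl) hnot
        have hP' : P (r.1, r.2 + M) := by rw [← hfc']; exact hPiso i' hi' hsv' hk'
        exact ⟨r.2 + M, by omega, hoff _ hP' (by simp only; omega)⟩
      · exact absurd hs0 h0N
      · exact absurd hsZ hzN
    · obtain ⟨M, hN', -, hend⟩ := ω.2.chain_S hY' hrS
      rcases hend with ⟨hM1, hnot⟩ | ⟨-, hs0⟩ | ⟨-, hsZ⟩
      · obtain ⟨i', hi', hfc', hsv', -, -, -, hk'⟩ := ω.2.isolated_of_usesSide_not_opp (hN' M hM1 le_rfl) hnot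
        have hP' : P (r.1, r.2 - M) := by rw [← hfc']; exact hPiso i' hi' hsv' hk'
        exact ⟨r.2 - M, by omega, hoff _ hP' (by simp only; omega)⟩
      · exact absurd hs0 h0S
      · exact absurd hsZ hzS
  -- the vertical chain end of `ρ`
  have hρNS : ω.2.UsesSide (ρ1, w.2) .N ∨ ω.2.UsesSide (ρ1, w.2) .S := by
    have hne := ω.2.sIn_ne_sOut hiρ
    have key : (ω.2.sIn iρ = .N ∨ ω.2.sOut iρ = .N) ∨ (ω.2.sIn iρ = .S ∨ ω.2.sOut iρ = .S) := by
      revert hWρ hninρ hnoutρ hne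
      cases ω.2.sIn iρ <;> cases ω.2.sOut iρ <;> decide
    rcases key with hN | hS
    · exact Or.inl ⟨iρ, hiρ, hfcρ, hN⟩
    · exact Or.inr ⟨iρ, hiρ, hfcρ, hS⟩
  obtain ⟨yρ, hyρ, hρ'⟩ : ∃ yρ : ℤ, yρ ≠ w.2 ∧ (ρ1, yρ) ∈ F4 := by
    rcases hρNS with hρN | hρS
    · obtain ⟨M, hS', -, hend⟩ := ω.2.chain_N hY hρN
      rcases hend with ⟨hM1, hnot⟩ | ⟨-, hs0⟩ | ⟨-, hsZ⟩
      · obtain ⟨i', hi', hfc', hsv', -, -, -, hk'⟩ := ω.2.isolated_of_usesSide_not_opp (hS' M hM1 le_rfl) hnot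
        have hP' : P (ρ1, w.2 + M) := by rw [← hfc']; exact hPiso i' hi' hsv' hk'
        exact ⟨w.2 + M, by omega, hoff _ hP' (by simp only; omega)⟩
      · exact absurd hs0 h0N
      · exact absurd hsZ hzN
    · obtain ⟨M, hN', -, hend⟩ := ω.2.chain_S hY' hρS
      rcases hend with ⟨hM1, hnot⟩ | ⟨-, hs0⟩ | ⟨-, hsZ⟩
      · obtain ⟨i', hi', hfc', hsv', -, -, -, hk'⟩ := ω.2.isolated_of_usesSide_not_opp (hN' M hM1 le_rfl) hnot
        have hP' : P (ρ1, w.2 - M) := by rw [← hfc']; exact hPiso i' hi' hsv' hk'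
        exact ⟨w.2 - M, by omega, hoff _ hP' (by simp only; omega)⟩
      · exact absurd hs0 h0S
      · exact absurd hsZ hzS
  -- the left entry turn
  have hσ : ω.2.fc sL ∈ F4 := by
    refine hoff _ hPσ fun e => ?_
    -- an isolated turn on the root row in column `X ≤ w.1 − 2` would be `r` or `ρ`
    have hm := hall _ hPσ
    simp only [S6, Finset.mem_insert, Finset.mem_singleton] at hm
    rcases hm with hm | hm | hm | hm | hm | hm
    · have := congrArg Prod.fst hm; rw [hcolL] at this; omega
    · have := congrArg Prod.fst hm; rw [hcolL] at this; simp only at this; omega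
    · have := congrArg Prod.snd hm; rw [hrow₀] at this; omega
    · have := congrArg Prod.snd hm; rw [hrow₁] at this; omega
    · have := congrArg Prod.snd hm; rw [hrow₀'] at this; omega
    · have := congrArg Prod.snd hm; rw [hrow₁'] at this; omega
  -- five distinct members
  let G5 : Finset Face := {ω.2.fc sL, (κ.1, w.2 + (Mu : ℤ)), (κ.1, w.2 - (Md : ℤ)), (r.1, yR), (ρ1, yρ)}
  have hG5 : G5 ⊆ F4 := by
    intro f hf
    simp only [G5, Finset.mem_insert, Finset.mem_singleton] at hf
    rcases hf with rfl | rfl | rfl | rfl | rfl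
    · exact hσ
    · exact hTκ
    · exact hBκ
    · exact hR'
    · exact hρ'
  have hG5card : G5.card = 5 := by
    simp only [G5]
    rw [Finset.card_insert_of_notMem, Finset.card_insert_of_notMem, Finset.card_insert_of_notMem,
      Finset.card_insert_of_notMem, Finset.card_singleton]
    · simp only [Finset.mem_singleton, Prod.mk.injEq, not_and]; intro e; omega
    · simp only [Finset.mem_insert, Finset.mem_singleton, Prod.mk.injEq, not_or, not_and]
      exact ⟨fun e => absurd e hκr, fun e => absurd e hκρ⟩
    · simp only [Finset.mem_insert, Finset.mem_singleton, Prod.mk.injEq, not_or, not_and]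
      exact ⟨fun _ => by omega, fun e => absurd e hκr, fun e => absurd e hκρ⟩
    · simp only [Finset.mem_insert, Finset.mem_singleton, not_or]
      refine ⟨fun e => ?_, fun e => ?_, fun e => ?_, fun e => ?_⟩ <;>
        (have := congrArg Prod.fst e; rw [hcolL] at this; simp only at this; omega)
  have := Finset.card_le_card hG5
  rw [hG5card] at this
  omega

end ΩG

end Literature.Probability.RandomPlanarGeometry.SAW.YangBaxter
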